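import Literature.Computability.Cryptography.LWELatticeNoiseProduct
import Literature.Computability.Cryptography.LWEBinaryHybrids
import Literature.Computability.Cryptography.LWEPiLawMaps
import Literature.Computability.Cryptography.UniformResidueSampling
import Literature.Probability.Distributions.IndepProductLawDistance
import Literature.Probability.Distributions.GaussianRejectionSampler
import HarnessLib

/-!
# Hybrid `ℬ₂`'s transformation with residues and the rejection sampler: the machine's law and its distance to `hybridT₂`

Topic `Computability/Cryptography` (LWE), grouping namespace `BLPRS2013`; law-level companion of the forthcoming program file for the inner transformation of
candidate `E₂` (`BLPRSSection4AssemblyExplicit.candE₂ = dimExtendThen 0 ∘ shiftThen ∘ hybridB₂`). `LWEBinaryHybrids.hybridT₂ χN M S` draws `C ← U(R^{k×n})` and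
noise columns `eᵢ ← χN` and maps sample `i` to `(Cᵀaᵢ + ēᵢ, bᵢ)`. The machine draws the COLUMNS of `C` as residues of coin words (`UniformResidueSampling.modLaw`) and
the noise coordinates by the tree's rejection sampler (`GaussianRejectionSampler.rejLaw`, centre `0`), which is justified because `χN = latticeNoiseLaw … r` is the
vector of `n` iid `D_{ℤ,Qr}` (`LWELatticeNoiseProduct.lean`). Everything PROVED; one definition with body (`machHybT2`); no named fact:

* `hybridT₂_eq_cols` (`hybridT₂` written with the column family `j ↦ (l ↦ C l j)`, uniform over `Fin n → Fin k → R`);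
* `machHybT2 L θ s N P w R M S` (the machine's law), **`tvDist_machHybT2_hybridT₂_le`** —
  `Δ(machHybT2, hybridT₂ χN M S) ≤ n·(k·Q/2ᴸ) + M·(n·Δ(rejLaw, D_{ℤ,√(π/θ)}))` whenever `χN = iidPMF (D_{ℤ,√(π/θ)}) n`
  (e.g. `latticeNoiseLaw (invScaledBasisZ n Q) r` with `Qr = √(π/θ)`).

## References

* Z. Brakerski, A. Langlois, C. Peikert, O. Regev, D. Stehlé, *Classical hardness of learning with errors*, STOC 2013; arXiv:1306.0281, Lemma 4.9 (proof, `ℬ₂`)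
  and §5. [BrakerskiEtAl2013]
* C. Gentry, C. Peikert, V. Vaikuntanathan, *Trapdoors for hard lattices…*, STOC 2008, §4.1 (sampling `D_{ℤ,s,c}` by rejection). [GentryPeikertVaikuntanathan2008]
* O. Goldreich, *Foundations of Cryptography I*, CUP 2001, §3.2.1–§3.2.3. [Goldreich2001]
-/

noncomputable section

open scoped ENNReal
open PMF Literature.Probability.Distributions Literature.Algebra.EuclideanLattices Matrix

namespace Literature.Computability.Cryptography

namespace BLPRS2013

open LWE

section Cols

variable {n k : ℕ} {R : Type} [CommRing R] [Fintype R]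

omit [Fintype R] in
/-- `Cᵀ a` through the columns of `C`: `(Cᵀ a)ⱼ = ⟨column j, a⟩`. [folklore] -/
theorem transpose_mulVec_eq_cols (C : Matrix (Fin k) (Fin n) R) (a : Fin k → R) :
    Cᵀ *ᵥ a = fun j => (fun l => C l j) ⬝ᵥ a := by
  funext j
  simp [Matrix.mulVec, dotProduct, Matrix.transpose_apply]

/-- The column family of a uniform matrix is uniform over `Fin n → Fin k → R`. [folklore] -/
theorem uniformOfFintype_matrix_map_cols :
    (PMF.uniformOfFintype (Matrix (Fin k) (Fin n) R)).map (fun C : Matrix (Fin k) (Fin n) R => fun j l => C l j) =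
      PMF.uniformOfFintype (Fin n → Fin k → R) := by
  classical
  have : (fun C : Matrix (Fin k) (Fin n) R => fun j l => C l j) = ⇑(Matrix.transposeAddEquiv (Fin k) (Fin n) R).toEquiv := by
    funext C; rfl
  rw [this]
  exact uniformOfFintype_map_equiv _

/-- **`hybridT₂` through columns**: draw the column family uniformly, add the noise coordinatewise. [cite: BrakerskiEtAl2013, Lemma 4.9 (proof, ℬ₂)] -/
theorem hybridT₂_eq_cols (χN : PMF (Fin n → ℤ)) (M : ℕ) (S : Fin M → (Fin k → R) × R) :
    hybridT₂ χN M S = (PMF.uniformOfFintype (Fin n → Fin k → R)).bind fun cols =>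
      (iidPMF χN M).map fun es i => ((fun j => cols j ⬝ᵥ (S i).1 + ((es i j : ℤ) : R)), (S i).2) := by
  classical
  unfold hybridT₂
  rw [← uniformOfFintype_matrix_map_cols, PMF.bind_map]
  congr 1

end Cols

/-! ### The machine's law and its distance -/

section Machine

variable {n k Q : ℕ} [NeZero Q]

/-- **The machine's hybrid-`T₂` law**: columns from `L`-bit residues, noise coordinates from the rejection sampler at centre `0`.
[cite: BrakerskiEtAl2013, Lemma 4.9 (proof, ℬ₂) and §5; GentryPeikertVaikuntanathan2008, §4.1] -/
def machHybT2 (L : ℕ) (θ : ℚ) (s N P w R M : ℕ) (S : Fin M → (Fin k → ZMod Q) × ZMod Q) : PMF (Fin M → (Fin n → ZMod Q) × ZMod Q) :=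
  (iidPMF (iidPMF (modLaw (2 ^ L) Q) k) n).bind fun cols =>
    (iidPMF (iidPMF (GaussRej.rejLaw θ 0 s N P w R) n) M).map fun es i => ((fun j => cols j ⬝ᵥ (S i).1 + ((es i j : ℤ) : ZMod Q)), (S i).2)

/-- **The machine's law is close to `hybridT₂ χN`** when `χN` is the iid discrete Gaussian the sampler targets:
`Δ ≤ n·(k·Q/2ᴸ) + M·(n·Δ(rejLaw, D_{ℤ,√(π/θ)}))`. [cite: BrakerskiEtAl2013, §5; Goldreich2001, §3.2.1, §3.2.3] -/
theorem tvDist_machHybT2_hybridT₂_le (L : ℕ) (θ : ℚ) (s N P w R M : ℕ) (S : Fin M → (Fin k → ZMod Q) × ZMod Q) {χN : PMF (Fin n → ℤ)}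
    (hχ : χN = iidPMF (discreteGaussianInt (Real.sqrt (Real.pi / θ)) 0) n) :
    (machHybT2 (n := n) L θ s N P w R M S).tvDist (hybridT₂ χN M S) ≤
      n * (k * ((Q : ℝ) / 2 ^ L)) + M * (n * (GaussRej.rejLaw θ 0 s N P w R).tvDist (discreteGaussianInt (Real.sqrt (Real.pi / θ)) 0)) := by
  rw [hybridT₂_eq_cols, machHybT2]
  refine (PMF.tvDist_triangle_holds _ ((PMF.uniformOfFintype (Fin n → Fin k → ZMod Q)).bind fun cols =>
    (iidPMF (iidPMF (GaussRej.rejLaw θ 0 s N P w R) n) M).map fun es i => ((fun j => cols j ⬝ᵥ (S i).1 + ((es i j : ℤ) : ZMod Q)), (S i).2)) _).trans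
    (add_le_add ?_ ?_)
  · -- the columns: residues against uniform
    refine (tvDist_bind_left_le _ _ _).trans ?_
    rw [← Literature.Probability.Distributions.indepLaw_uniformOfFintype n, indepLaw_const]
    refine (tvDist_iidPMF_le _ _ n).trans (mul_le_mul_of_nonneg_left ?_ (Nat.cast_nonneg n))
    have h := tvDist_iidPMF_modLaw_le (2 ^ L) Q k
    push_cast at h
    exact h
  · -- the noise: the sampler against the discrete Gaussian, coordinatewise and samplewise
    refine PMF.tvDist_bind_le_of_forall_le _ _ _ fun cols => ?_
    refine (PMF.tvDist_map_le_holds _ _ _).trans ?_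
    rw [hχ]
    refine (tvDist_iidPMF_le _ _ M).trans (mul_le_mul_of_nonneg_left ?_ (Nat.cast_nonneg M))
    simpa using tvDist_iidPMF_le (GaussRej.rejLaw θ 0 s N P w R) (discreteGaussianInt (Real.sqrt (Real.pi / θ)) 0) n

end Machine

end BLPRS2013

end Literature.Computability.Cryptography

end
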